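import Summits.ResolutionOfSingularities.ResolutionOfSingularities.Theorems.PurelyInseparableDim4SpineWin
import Summits.ResolutionOfSingularities.ResolutionOfSingularities.Theorems.PurelyInseparableDim4PolyhedraCF
import Summits.ResolutionOfSingularities.ResolutionOfSingularities.Theorems.PurelyInseparableDim4PolyhedraCFTwo
import Summits.ResolutionOfSingularities.ResolutionOfSingularities.Theorems.PurelyInseparableDim4SpineCertCycles
import HarnessLib
import HarnessLib.Audit.Tags

/-!
# [OURS · res-dim4-pi PR-9d, spine export] `Q-CF∀` on the spine reduces to the cardinality-first WEAK game

Cell `res-dim4-pi` (D-0157 DOOR 2), brick **PR-9d** (seat `res-dim4-p-10`, «width 10»; desk WORD #29 (b)).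
The census' open question `Q-CF∀` — «ONE cardinality-first positional strategy (a permissible centre of least
cardinality at every position, ties broken freely) wins Hironaka's pure game from every position of `SpinePos`»
(the engines' EN-11: observed from all 37 259 S-1a roots and all 1 953 cycle-entry states at `q = 2`) — read
through `PurelyInseparableDim4PolyhedraCF`:

* `SpineCF.winsCF_of_forcesCF` — a cardinality-first forcing tree (all four coordinates active) puts the
  position in player A's attractor of the CARDINALITY-FIRST-RESTRICTED pure game (legality «not won ∧
  permissible ∧ least cardinality», the reading of `res-dim4-p-7`'s `SpineWinCert.wins_cardFirst_get` with the
  pure move, over `res-dim4-p-14`'s `Game.Wins`);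
* **`SpineCF.forall_winsCF_of_weakWinCF`**: if cardinality-first forces the WEAK win in every `I ⊆ Fin 4`
  (`PolyhedraGame.WeakWinCF`, hypothesis-shape, not asserted), then every spine position is won by the
  cardinality-first-restricted player A (`0 < q`);
* **`SpineCF.exists_cardFirst_purePositionalWin_of_weakWinCF`**: under the same hypothesis there is ONE
  positional strategy of TY-9's pure game that is cardinality-first at every not-yet-won position AND wins from
  every position (`IsPurePositionalWin`) — `Q-CF∀` itself, modulo its interior phase.

[OURS · counted 0 · elementary · AI work weaker than expert review] Nothing here asserts `Q-CF∀`; nothing here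
proves resolution of singularities in dimension ≥ 4 / characteristic `p`.
bears_on: LADDER-RESOLUTION:D157-DOOR2 (res-dim4-pi · PR-9d). Supports stmt-ResolutionOfSingularities-16155
(helper).
-/

set_option linter.dupNamespace false -- mandated namespace of this single-conjunct summit

noncomputable section

namespace Summit.ResolutionOfSingularities.ResolutionOfSingularities.Theorems.PIDim4

namespace SpineCF

open Finset
open Literature.AlgebraicGeometry.Resolution
open Literature.AlgebraicGeometry.Resolution.CentreBlowup

/-- LEGALITY of the cardinality-first-restricted pure spine game: not yet won, permissible, of least
cardinality among the permissible centres (the census' MODE-1h support shadow, every tie allowed). [folklore] -/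
def CFLegal (q : ℕ) (A : SpinePos) (J : Finset (Fin 4)) : Prop :=
  ¬ SpineWon q A ∧ SpinePermissible q J A ∧ ∀ J' : Finset (Fin 4), SpinePermissible q J' A → J.card ≤ J'.card

/-- ANSWERS of player B in the pure game: a chart `j ∈ J`. [folklore] -/
def PureSucc (q : ℕ) (A : SpinePos) (J : Finset (Fin 4)) (A' : SpinePos) : Prop :=
  ∃ j ∈ J, A' = pureMove q J j A

/-- A cardinality-first move of part PR-9d (all four coordinates active) is a legal move of the
cardinality-first-restricted spine game, at a not-yet-won position. [folklore] -/
theorem cfLegal_of_isCF {q : ℕ} {A : SpinePos} {J : Finset (Fin 4)} (hA : ¬ SpineWon q A)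
    (hJ : PolyhedraGame.IsCF q Finset.univ J A) : CFLegal q A J :=
  ⟨hA, hJ.2.1, fun J' hJ' => hJ.2.2 J' (Finset.subset_univ J') hJ'⟩

/-- A cardinality-first forcing tree for the strict win (all coordinates active) puts the position in player
A's attractor of the cardinality-first-restricted pure game. [folklore] -/
theorem winsCF_of_forcesCF {q : ℕ} {A : SpinePos}
    (h : PolyhedraGame.ForcesCF (PolyhedraGame.StrictWon q Finset.univ) q Finset.univ A) :
    Game.Wins (CFLegal q) (PureSucc q) A := by
  induction h with
  | won hW => exact Game.Wins.terminal fun J hJ => hJ.1 ((SpineWin.spineWon_iff q _).mpr hW)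
  | @step P J hJ _ ih =>
    rcases Classical.em (SpineWon q P) with hw | hw
    · exact Game.Wins.terminal fun J hJ => hJ.1 hw
    · refine Game.Wins.move (m := J) (cfLegal_of_isCF hw hJ) fun y hy => ?_
      obtain ⟨j, hj, rfl⟩ := hy
      exact ih j hj

/-- **`Q-CF∀` (attractor form) from the cardinality-first WEAK game**: if cardinality-first forces the weak win
in every set of active coordinates of `Fin 4`, every spine position is won by the cardinality-first-restricted
player A (`0 < q`). [folklore] -/
theorem forall_winsCF_of_weakWinCF
    (hweak : ∀ I : Finset (Fin 4), PolyhedraGame.WeakWinCF (Fin 4) I) {q : ℕ} (hq : 0 < q)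
    (A : SpinePos) : Game.Wins (CFLegal q) (PureSucc q) A :=
  winsCF_of_forcesCF (PolyhedraGame.forcesCF_strict_of_weakWinCF Finset.univ (fun I _ => hweak I) hq A)

/-- At a not-yet-won position a cardinality-first legal move exists (the point is permissible, and some
permissible centre has least cardinality — `res-dim4-p-8`, `SpineCert.exists_cardFirst_of_exists`). [folklore] -/
theorem exists_cfLegal_of_not_spineWon {q : ℕ} {A : SpinePos} (hA : ¬ SpineWon q A) :
    ∃ J, CFLegal q A J := by
  obtain ⟨J, hJ, hmin⟩ :=
    SpineCert.exists_cardFirst_of_exists ⟨Finset.univ, SpineCert.spinePermissible_univ_of_not_spineWon hA⟩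
  exact ⟨J, hA, hJ, hmin⟩

/-- **`Q-CF∀` (strategy form) from the cardinality-first WEAK game**: ONE positional strategy of TY-9's pure
game, cardinality-first at every not-yet-won position, winning from every position. (Positional determinacy
of the restricted game, `res-dim4-p-14`'s `Game.exists_isWinningPositional_of_forall_wins`.) [folklore] -/
theorem exists_cardFirst_purePositionalWin_of_weakWinCF
    (hweak : ∀ I : Finset (Fin 4), PolyhedraGame.WeakWinCF (Fin 4) I) {q : ℕ} (hq : 0 < q) :
    ∃ σ : SpineStrategy, IsPurePositionalWin q σ ∧
      ∀ A : SpinePos, ¬ SpineWon q A →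
        ∀ J' : Finset (Fin 4), SpinePermissible q J' A → (σ A).card ≤ J'.card := by
  obtain ⟨σ, hσ⟩ := Game.exists_isWinningPositional_of_forall_wins (CFLegal q) (PureSucc q)
    (forall_winsCF_of_weakWinCF hweak hq)
  have hleg : ∀ A : SpinePos, ¬ SpineWon q A → CFLegal q A (σ A) :=
    fun A hA => hσ.1 A (exists_cfLegal_of_not_spineWon hA)
  refine ⟨σ, ⟨fun A hA => (hleg A hA).2.1, ?_⟩, fun A hA => (hleg A hA).2.2⟩
  rintro ⟨A, hplay⟩
  refine hσ.2 ⟨A, fun k => ?_⟩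
  obtain ⟨hwon, j, hj, hnext⟩ := hplay k
  exact ⟨hleg (A k) hwon, j, hj, hnext⟩

/-- **Q-CF∀ on the spine, hypothesis shrunk to dimensions 3 and 4**: since cardinality-first wins the weak game
in every set of at most two active coordinates (`PolyhedraGame.weakWinCF_of_card_le_two`), ONE cardinality-first
positional strategy winning TY-9's pure game from every position exists as soon as cardinality-first forces the
weak win in every set of THREE or FOUR active coordinates of `Fin 4`. [folklore] -/
theorem exists_cardFirst_purePositionalWin_of_weakWinCF_three_four
    (hweak : ∀ I : Finset (Fin 4), 3 ≤ I.card → PolyhedraGame.WeakWinCF (Fin 4) I) {q : ℕ} (hq : 0 < q) :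
    ∃ σ : SpineStrategy, IsPurePositionalWin q σ ∧
      ∀ A : SpinePos, ¬ SpineWon q A →
        ∀ J' : Finset (Fin 4), SpinePermissible q J' A → (σ A).card ≤ J'.card := by
  refine exists_cardFirst_purePositionalWin_of_weakWinCF (fun I => ?_) hq
  rcases Nat.lt_or_ge I.card 3 with hI | hI
  · exact PolyhedraGame.weakWinCF_of_card_le_two (by omega)
  · exact hweak I hI

end SpineCF

end Summit.ResolutionOfSingularities.ResolutionOfSingularities.Theorems.PIDim4

end
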